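import Summits.Ventures.Crystal3D.Theorems.StickyWulffConstantTextureBuildLayerDescentLevel
import Summits.Ventures.Crystal3D.Theorems.StickyWulffConstantTextureBuildLayerPropagationFrame
import HarnessLib

/-!
# TB-1 brick L-PROP-5 (prescribed frame): the per-level descent from a ball of an ALREADY PRESENTED region, in the SAME frame — one frame per grain region
# (lane T, crux `TextureLiminfV5`, stmt-Ventures-23912; memo HOME/wulff-p2/g25/SLAB-PLATES-g25.md §7–§8 (`Mesh₄.hagreeFr`, `hpres`))

HONEST FRAMING. Venture `Summits/Ventures/Crystal3D` (cell `crystal3d-full`), route `route-Ventures-StickyWulffConstant`, helper `--supports` the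
law-v5 crux `TextureLiminfV5` (stmt-Ventures-23912).  Frame bookkeeping (census-free, standard axioms) over '…TextureBuildLayerDescentLevel'
(`exists_local_stacking_descent_shell`), verbatim in the style of `descentPropagation` ('…LayerDescentFrame').  No cover is built; F-C1 not moved.

WHY.  `exists_frame_descent` ('…DescentFromShell') reads a presentation from any close-packed ball but in a frame chosen by that ball's shell — on an FCC region two
base balls may pick two different `{111}` layerings, and the mesh then owes a frame witness (`Mesh₄.hagreeFr`).  The constructor avoids this by reading every
further column of the same grain region IN THE FRAME IT ALREADY HAS: a ball `b` of an already certified region is a site of `stacking L b₀ σ₀` with its twelve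
neighbours occupied, i.e. (after `stacking_rebase`) the centre of a tiny chart `stacking L b σ` of radius `r ≥ 1` in the SAME frame `L`.  This file runs the
per-level descent from such a tiny chart:

* **`descentPropagation_shell`** — `x` a unit packing; `stacking L b σ` carries every ball within `r ≥ 1` of `b` and is complete there; radii `N m ≥ 2`;
  close-packed shells asked per level (`|v₃ + m√(2/3)| ≤ 1`, `‖v‖ ≤ m + N m + 2`, `v = L⁻¹(x c − b)`).  Conclusion: a Hägg word `s` such that for every
  `M ≤ K + 1`, unless an inclined-twin witness occurs at a level `≤ M` (level `0`: `σ(−1) = σ(0)` with a located HCP-arranged ball of index `≤ N 0 + 1`; level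
  `m ≥ 1`: `s(−m−1) = s(−m)` with one of index `≤ N m + 1`), every site `L(barlowPos 1 √(2/3) s (−M) i j) + b`, `|i| + |j| ≤ N M`, is a ball — SAME `L`, SAME `b`.
-/

noncomputable section

namespace Summit.Ventures.Crystal3D.Theorems

open Literature.Geometry.DiscreteGeometry Literature.MathematicalPhysics.StatisticalMechanics
open RealInnerProductSpace Summit.Ventures.Crystal3D.L2B Summit.Ventures.Crystal3D.Theorems.LocalStacking
open Summit.Ventures.Crystal3D.Cruxes.TextureLiminf.TexShadow (stacking)

variable {N₀ : ℕ} {x : Fin N₀ → EuclideanSpace ℝ (Fin 3)}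

/-- **THE PER-LEVEL DESCENT IN A PRESCRIBED FRAME.**  See the module docstring. -/
theorem descentPropagation_shell (hx : IsUnitPacking x) {L : EuclideanSpace ℝ (Fin 3) ≃ₗᵢ[ℝ] EuclideanSpace ℝ (Fin 3)}
    {b : EuclideanSpace ℝ (Fin 3)} {σ : ℤ → ℤ} (hσ : IsHaggSeq σ) {r : ℝ} (hr : 1 ≤ r)
    (hcarry : ∀ c, dist (x c) b ≤ r → x c ∈ stacking L b σ)
    (hcomp : ∀ w ∈ stacking L b σ, dist w b ≤ r → w ∈ Set.range x)
    (N : ℕ → ℤ) (K : ℕ) (hN2 : ∀ m, m ≤ K + 1 → 2 ≤ N m)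
    (hcp : ∀ c : Fin N₀, ∀ m : ℕ, m ≤ K + 1 → |(L.symm (x c - b)) 2 + m * Real.sqrt (2 / 3)| ≤ 1 →
      ‖L.symm (x c - b)‖ ≤ m + N m + 2 → IsClosePackedShell x c) :
    ∃ s : ℤ → ℤ, IsHaggSeq s ∧ ∀ M : ℕ, M ≤ K + 1 →
      ¬ (σ (-1) = σ 0 ∧ ∃ i j : ℤ, |i| + |j| ≤ N 0 + 1 ∧ ∃ c : Fin N₀,
          x c = L (barlowPos 1 (Real.sqrt (2 / 3)) s 0 i j) + b ∧ IsArrangedIn (contactShell x c) hcpKissingPattern) →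
      (¬ ∃ m : ℕ, 1 ≤ m ∧ m ≤ M ∧ s (-(m : ℤ) - 1) = s (-(m : ℤ)) ∧ ∃ i j : ℤ, |i| + |j| ≤ N m + 1 ∧ ∃ c : Fin N₀,
          x c = L (barlowPos 1 (Real.sqrt (2 / 3)) s (-(m : ℤ)) i j) + b ∧ IsArrangedIn (contactShell x c) hcpKissingPattern) →
      ∀ i j : ℤ, |i| + |j| ≤ N M → L (barlowPos 1 (Real.sqrt (2 / 3)) s (-(M : ℤ)) i j) + b ∈ Set.range x := by
  set V : Set (EuclideanSpace ℝ (Fin 3)) := Set.range fun j => (2 : ℝ) • x j with hVdef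
  have hV : IsUnitBallPacking V := isUnitBallPacking_range_two_smul hx
  set W : Set (EuclideanSpace ℝ (Fin 3)) := {y | (2 : ℝ) • b + L y ∈ V} with hWdef
  have hW : IsUnitBallPacking W := hV.preimage ((2 : ℝ) • b) L
  have memW : ∀ y, y ∈ W ↔ ∃ c, (2 : ℝ) • x c = (2 : ℝ) • b + L y := fun y => by
    simp only [hWdef, hVdef, Set.mem_setOf_eq, Set.mem_range]
  have halfW : ∀ {y : EuclideanSpace ℝ (Fin 3)} {c : Fin N₀}, (2 : ℝ) • x c = (2 : ℝ) • b + L y →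
      x c - b = L ((2 : ℝ)⁻¹ • y) := by
    intro y c h
    have h2 : (2 : ℝ) • (x c - b) = L y := by rw [smul_sub, h]; abel
    rw [map_smul, ← h2, smul_smul]; norm_num
  have halfW' : ∀ {y : EuclideanSpace ℝ (Fin 3)} {c : Fin N₀}, (2 : ℝ) • x c = (2 : ℝ) • b + L y →
      L.symm (x c - b) = (2 : ℝ)⁻¹ • y := by
    intro y c h; rw [halfW h, LinearIsometryEquiv.symm_apply_apply]
  have distW : ∀ {y : EuclideanSpace ℝ (Fin 3)} {c : Fin N₀}, (2 : ℝ) • x c = (2 : ℝ) • b + L y → dist (x c) b = ‖y‖ / 2 := by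
    intro y c h
    rw [dist_eq_norm, halfW h, LinearIsometryEquiv.norm_map, norm_smul, Real.norm_of_nonneg (by norm_num)]; ring
  have ballW : ∀ {y : EuclideanSpace ℝ (Fin 3)} {c : Fin N₀}, (2 : ℝ) • x c = (2 : ℝ) • b + L y →
      ∀ (s : ℤ → ℤ) (k i j : ℤ), y = barlowPos 2 layerSpacing s k i j → x c = L (barlowPos 1 (Real.sqrt (2 / 3)) s k i j) + b := by
    intro y c h s k i j hy
    have h1 := halfW h
    rw [hy, barlowPos_two_eq_two_smul, smul_smul, inv_mul_cancel₀ (two_ne_zero' ℝ), one_smul] at h1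
    rw [← h1]; abel
  -- (A)/(B): the tiny chart in the frame
  have siteW : ∀ k i j : ℤ, ‖barlowPos 1 (Real.sqrt (2 / 3)) σ k i j‖ ≤ r → barlowPos 2 layerSpacing σ k i j ∈ W := by
    intro k i j hq
    set q := barlowPos 1 (Real.sqrt (2 / 3)) σ k i j with hqdef
    have hmem : L q + b ∈ stacking L b σ := ⟨q, ⟨k, i, j, rfl⟩, rfl⟩
    have hd : dist (L q + b) b ≤ r := by rwa [dist_eq_norm, add_sub_cancel_right, LinearIsometryEquiv.norm_map]
    obtain ⟨c, hc⟩ := hcomp _ hmem hd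
    refine (memW _).2 ⟨c, ?_⟩
    rw [hc, barlowPos_two_eq_two_smul, map_smul, smul_add]
    abel
  have pointB : ∀ y ∈ W, ‖y‖ ≤ 2 * r → y ∈ barlowStacking 2 layerSpacing σ := by
    intro y hy hyn
    obtain ⟨c, hc⟩ := (memW y).1 hy
    have hd : dist (x c) b ≤ r := by rw [distW hc]; linarith
    obtain ⟨q, hq, hcq⟩ := hcarry c hd
    have hyq : y = (2 : ℝ) • q := by
      have hcq' : L q + b = x c := hcq
      have h1 : x c - b = L q := by rw [← hcq', add_sub_cancel_right]
      rw [halfW hc] at h1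
      have h2 := L.injective h1
      rw [← h2, smul_smul]; norm_num
    rw [hyq]
    exact (Summit.Ventures.Crystal3D.mem_barlowStacking_one_iff σ q).1 hq
  -- the centre and its shell in the frame
  have hσ0 : ((σ 0 : ℤ) : ℝ) = 1 ∨ ((σ 0 : ℤ) : ℝ) = -1 := by rcases hσ 0 with h | h <;> simp [h]
  have hσ1 : (-((σ (-1) : ℤ) : ℝ)) = 1 ∨ (-((σ (-1) : ℤ) : ℝ)) = -1 := by rcases hσ (-1) with h | h <;> simp [h]
  have h0W : (0 : EuclideanSpace ℝ (Fin 3)) ∈ W := by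
    have h := siteW 0 0 0 (by rw [norm_barlowPos_one, barlowPos_two_zero_eq_latPt, latPt_zero, norm_zero]; linarith)
    rwa [barlowPos_two_zero_eq_latPt, latPt_zero] at h
  have hS0 : kissingShell W 0 = layerShell ((σ 0 : ℤ) : ℝ) (-((σ (-1) : ℤ) : ℝ)) := by
    have hshell0 := kissingShell_barlowStacking_eq_layerShell hσ 0 0 0
    rw [show (0 : ℤ) - 1 = -1 from by norm_num, barlowPos_two_zero_eq_latPt, latPt_zero] at hshell0
    rw [← hshell0]
    ext y
    simp only [mem_kissingShell_iff, zero_add]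
    constructor
    · rintro ⟨hyW, hy2⟩
      exact ⟨pointB _ hyW (by rw [hy2]; linarith), hy2⟩
    · rintro ⟨hyB, hy2⟩
      refine ⟨?_, hy2⟩
      obtain ⟨k', i', j', hk'⟩ := hyB
      have hnorm' : ‖barlowPos 1 (Real.sqrt (2 / 3)) σ k' i' j'‖ ≤ r := by
        rw [norm_barlowPos_one, ← hk', hy2]; linarith
      rw [hk']
      exact siteW k' i' j' hnorm'
  -- the slab-cone hypothesis in the frame, per level
  have hcpW : ∀ u ∈ W, ∀ m : ℕ, m ≤ K + 1 → |u 2 + m * layerSpacing| ≤ 2 → ‖u‖ ≤ 2 * m + 2 * (N m) + 4 →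
      IsArrangedIn (kissingShell W u) fccKissingPattern ∨ IsArrangedIn (kissingShell W u) hcpKissingPattern := by
    intro u hu m hm hu2 hun
    obtain ⟨c, hc⟩ := (memW u).1 hu
    have hshell : kissingShell W u = L ⁻¹' kissingShell V ((2 : ℝ) • x c) := by
      rw [hWdef, kissingShell_moved, ← hc]
    have hcp' : IsClosePackedShell x c := by
      refine hcp c m hm ?_ ?_
      · rw [halfW' hc, PiLp.smul_apply, smul_eq_mul]
        have e : (2 : ℝ)⁻¹ * u 2 + m * Real.sqrt (2 / 3) = (2 : ℝ)⁻¹ * (u 2 + m * layerSpacing) := by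
          rw [layerSpacing]; ring
        rw [e, abs_mul, abs_of_pos (by norm_num : (0 : ℝ) < 2⁻¹)]
        linarith
      · rw [halfW' hc, norm_smul, Real.norm_of_nonneg (by norm_num)]
        have : ((N m : ℤ) : ℝ) = (N m : ℝ) := rfl
        linarith
    rw [hshell, hVdef, kissingShell_range_two_smul]
    exact hcp'.imp (fun h => h.preimage L) (fun h => h.preimage L)
  have witness : ∀ (s : ℤ → ℤ) (k i j : ℤ), barlowPos 2 layerSpacing s k i j ∈ W →
      IsArrangedIn (kissingShell W (barlowPos 2 layerSpacing s k i j)) hcpKissingPattern →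
      ∃ c : Fin N₀, x c = L (barlowPos 1 (Real.sqrt (2 / 3)) s k i j) + b ∧ IsArrangedIn (contactShell x c) hcpKissingPattern := by
    intro s k i j hmem harr'
    obtain ⟨c, hc⟩ := (memW _).1 hmem
    refine ⟨c, ballW hc s _ _ _ rfl, ?_⟩
    have hshell : kissingShell W (barlowPos 2 layerSpacing s k i j) = L ⁻¹' kissingShell V ((2 : ℝ) • x c) := by
      rw [hWdef, kissingShell_moved, ← hc]
    rw [hshell, hVdef, kissingShell_range_two_smul] at harr'
    have h := harr'.preimage L.symm
    have e : L.symm ⁻¹' (L ⁻¹' contactShell x c) = contactShell x c := by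
      ext z; simp
    rwa [e] at h
  -- the sign bookkeeping of the level-0 clause: `−σ(−1) = −σ(0)` iff `σ(−1) = σ(0)`
  have hsign : (-((σ (-1) : ℤ) : ℝ)) = -((σ 0 : ℤ) : ℝ) ↔ σ (-1) = σ 0 := by
    constructor
    · intro h; exact_mod_cast neg_injective h
    · intro h; rw [h]
  -- run the descent and undo the frame
  obtain ⟨s, hs, hdesc⟩ := exists_local_stacking_descent_shell hW hσ0 hσ1 h0W hS0 N K hN2 hcpW
  refine ⟨s, hs, fun M hM hnow0 hnow i j hij => ?_⟩
  have hnow0' : ¬ ((-((σ (-1) : ℤ) : ℝ)) = -((σ 0 : ℤ) : ℝ) ∧ ∃ i j : ℤ, |i| + |j| ≤ N 0 + 1 ∧ barlowPos 2 layerSpacing s 0 i j ∈ W ∧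
      IsArrangedIn (kissingShell W (barlowPos 2 layerSpacing s 0 i j)) hcpKissingPattern) := by
    rintro ⟨hneg, i', j', hij', hmem, harr'⟩
    exact hnow0 ⟨hsign.1 hneg, i', j', hij', witness s 0 i' j' hmem harr'⟩
  have hnow' : ¬ ∃ m : ℕ, 1 ≤ m ∧ m ≤ M ∧ s (-(m : ℤ) - 1) = s (-(m : ℤ)) ∧ ∃ i j : ℤ, |i| + |j| ≤ N m + 1 ∧
      barlowPos 2 layerSpacing s (-(m : ℤ)) i j ∈ W ∧
      IsArrangedIn (kissingShell W (barlowPos 2 layerSpacing s (-(m : ℤ)) i j)) hcpKissingPattern := by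
    rintro ⟨m, hm1, hmM, htyp, i', j', hij', hmem, harr'⟩
    exact hnow ⟨m, hm1, hmM, htyp, i', j', hij', witness s _ i' j' hmem harr'⟩
  obtain ⟨c, hc⟩ := (memW _).1 (hdesc M hM hnow0' hnow' i j hij)
  exact ⟨c, ballW hc s _ _ _ rfl⟩

end Summit.Ventures.Crystal3D.Theorems

end
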